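import Literature.AlgebraicGeometry.Deformation.FlatDeformationTransitionData
import Literature.AlgebraicGeometry.Deformation.SmoothSchemeLiftTransitionDataLift
import HarnessLib

/-!
# Chart lifts of a morphism of flat deformations along a square-zero extension, intertwining the transition lifts
# (Hartshorne, *Deformation Theory*, Prop. 4.4 and the proof of Thm. 10.2 (a): «the obstruction is functorial», chart level)

Layer `Literature/AlgebraicGeometry/Deformation`, namespace `Literature.AlgebraicGeometry.Deformation` (THEOREMS only: no
definition, no instance, no notation, no named fact).  Currency of ★ c2b `FlatDeformationTransitionData` /
`FlatDeformationTransitionDataCover` and ★ GAP-1 `SmoothSchemeLiftTransitionDataLift` (as in the `f := 𝟙` sibling ★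
`FlatDeformationTwoChartSystems`): `A` a `k`-algebra, `J ⊆ A` an ideal with `J² = 0`, `π' : A ⧸ J → k` the augmentation;
TWO closed fibres `X`, `Y` over `k` (`X` smooth; `k`-structures `halgX`, `halgY`) with flat deformations `𝒳`, `𝒴` over `A ⧸ J`
(`(A ⧸ J)`-structures `halg𝒳`, `halg𝒴`), closed-fibre inclusions `i : X → 𝒳`, `i' : Y → 𝒴`, and A MORPHISM OF DEFORMATIONS
`𝒻 : 𝒴 → 𝒳` over `Spec (A ⧸ J)` restricting to `f : Y → X` on the closed fibres (ONE commuting square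
`f ≫ i = i' ≫ 𝒻`).  On the `X`-side: a principal affine cover `U j` (`U j ∩ U l = D(b j l)`) below opens `𝒰 j ⊆ 𝒳`, chart
trivialisations `e j : (A ⧸ J) ⊗_k Γ(X, U j) ≃ Γ(𝒳, 𝒰 j)` over the closed fibres (`he`) with overlap restrictions `ε₁ ε₂` (`hε₁ hε₂`),
and `A`-lifts `ψX j l` of the transition automorphisms `transition (ε₁ j l) (ε₂ j l) = ε₂⁻¹ ε₁` (GAP-1's clause (L), `hLX`); on the
`Y`-side the same letters `U' j = f⁻¹ U j`, `𝒰' j ⊆ 𝒻⁻¹ 𝒰 j`, `d`, `hd`, `δ₁ δ₂`, `hδ₁ hδ₂`, `ψY`, `hLY`.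

THE PRINT. [Hartshorne2010, Prop. 4.4, p. 30] (infinitesimal lifting property of a formally smooth algebra along a nilpotent
surjection) and [Hartshorne2010, Thm. 10.2 (a), proof, p. 81] with [Hartshorne2010, Cor. 4.8, pp. 32–33]: the local charts
`U_i × Spec C` of a deformation are unique up to automorphisms inducing the identity on the closed fibre, so a morphism of
deformations is, chart by chart, a family of algebra maps `F_i` between the trivial charts compatible with the gluing data;
lifting each `F_i` one infinitesimal step further (Prop. 4.4) keeps the compatibility MODULO THE KERNEL of the step.  THIS FILE:

* §1 `exists_algHom_lift` — the HOM analogue of ★ `SmoothAffineDeformation.exists_algEquiv_lift`: for `B₀` formally smooth over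
  `k` and `π' : A' ↠ A` with nilpotent kernel, every `A`-algebra map `G : A ⊗_k B₀ → A ⊗_k C₀` is the reduction of an
  `A'`-algebra map `F : A' ⊗_k B₀ → A' ⊗_k C₀` (`(π' ⊗ 1) ∘ F = G ∘ (π' ⊗ 1)`; Mathlib `Algebra.FormallySmooth.liftOfSurjective`, ★
  `baseChangeHom`, ★ `map_baseChangeHom_of_lift`; no flatness needed).
* §2 `reductionHom_algHom_restrict` — the HOM analogue of ★ GAP-1 `reductionHom_algEquiv_restrict`: if `F` (over `A`) lifts `G`
  (over `A₀`) on `Γ(X, V) → Γ(Y, V′)` and `ρ`, `ρ₀` are their restrictions to `Γ(X, W) → Γ(Y, W′)`, `W = D(f) ⊆ V` (through the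
  characterised base changes), then `ρ` lifts `ρ₀` (★ `algHom_ext_of_basicOpen`, ★ `reductionHom_baseChangeMap`).
* §3 **`exists_chartLifts_of_morphism`** — there are `A`-algebra maps `F j : A ⊗_k Γ(X, U j) → A ⊗_k Γ(Y, U' j)` with
  (hF) `F j (1 ⊗ c) − 1 ⊗ f♯ c ∈ (mk_J⁻¹ 𝔫₀)·(A ⊗_k Γ(Y, U' j))` for any ideal `𝔫₀ ⊇ ker π'` of `A ⧸ J`, and (hFψ)
  `F_l| (ψX j l (1 ⊗ c)) − ψY j l (F_j| (1 ⊗ c)) ∈ J·(A ⊗_k Γ(Y, U' j ∩ U' l))` for all characterised restrictions `F_j|, F_l|` —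
  LITERALLY the hypotheses `(F hF hFψ)` of ★ B2 `SmoothSchemeLiftObstructionFunctorialCech.exists_cechMD1_eq_comap_obstruction_sub`
  (at `A' := A`, `𝔫' := mk_J⁻¹ 𝔫₀`).  Road: `G j := (d j)⁻¹ ∘ 𝒻♯ ∘ e j` over `A ⧸ J`, `F j` an `A`-lift (§1); modulo `mk_J⁻¹ ker π'`
  the chart map IS `1 ⊗ f♯` (closed-fibre compatibilities `he`, `hd`, the square, ★ `ker_specialFibreHom_le`, ★
  `mem_comap_smul_top_of_reductionHom_mem`); modulo `J` (★ `reductionHom_eq_zero_iff`) the restrictions `F_j|, F_l|` reduce to the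
  explicit overlap maps `δ₁⁻¹ 𝒻♯ ε₁`, `δ₂⁻¹ 𝒻♯ ε₂` (§2), and both sides of the intertwining identity are `δ₂⁻¹ 𝒻♯ ε₁`.

Cell `hodgecm-mathlib` (D-0151), F-11 road (a′), MONO-G1 slot (3) rel₁ at the datum (`f := [2]` on the closed fibre of an abelian
scheme; F0P1b-plan (g2) (R138)/(R139), B-p14 (g21) closer census (D2)).  HC_CM is proved only modulo the 7 printed citations until
rung 0 closes — nothing here bears on a summit statement.

## References
* [Hartshorne2010] R. Hartshorne, *Deformation Theory*, GTM 257, Springer (2010): Prop. 4.4 (p. 30), Cor. 4.8 (pp. 32–33),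
  Thm. 10.2 (a) and its proof (p. 81), Cor. 10.3 (p. 82).
* [Hartshorne1977] R. Hartshorne, *Algebraic Geometry*, GTM 52 (1977): II.8 p. 172, III §4 p. 218.
-/

noncomputable section

-- `TopCat.Presheaf`/`TopCat.Sheaf` are not reducible (as in Mathlib's `AlgebraicGeometry/Modules`).
set_option backward.isDefEq.respectTransparency false

open CategoryTheory AlgebraicGeometry Opposite TopologicalSpace Limits
open scoped TensorProduct

universe u

namespace Literature.AlgebraicGeometry.Deformation

open Literature.AlgebraicGeometry.Motives Literature.AlgebraicGeometry.Morphisms SmoothAffineDeformation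

/-! ## §1 Ring level: `A`-algebra maps between trivial charts lift along a nilpotent surjection `π' : A' ↠ A` -/

section RingLevel

variable {k : Type*} [CommRing k] {A' : Type*} [CommRing A'] [Algebra k A'] {A : Type*} [CommRing A] [Algebra k A]
  {B₀ : Type*} [CommRing B₀] [Algebra k B₀] {C₀ : Type*} [CommRing C₀] [Algebra k C₀]

/-- An `R`-algebra map between trivial charts fixes `r ⊗ 1`. [cite: Hartshorne2010, Cor. 4.8 (proof), p. 33] -/
private theorem algHom_apply_tmul_one {R : Type*} [CommRing R] [Algebra k R] (u : R ⊗[k] B₀ →ₐ[R] R ⊗[k] C₀) (r : R) :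
    u (r ⊗ₜ 1) = r ⊗ₜ 1 := by
  have e : (r ⊗ₜ[k] (1 : B₀) : R ⊗[k] B₀) = algebraMap R (R ⊗[k] B₀) r := by
    rw [Algebra.TensorProduct.algebraMap_apply, Algebra.algebraMap_self, RingHom.id_apply]
  have e' : (r ⊗ₜ[k] (1 : C₀) : R ⊗[k] C₀) = algebraMap R (R ⊗[k] C₀) r := by
    rw [Algebra.TensorProduct.algebraMap_apply, Algebra.algebraMap_self, RingHom.id_apply]
  rw [e, e', AlgHom.commutes]

/-- **Chart maps lift (the infinitesimal lifting property, relative form).** For `B₀` formally smooth over `k` and a surjection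
of `k`-algebras `π' : A' ↠ A` with nilpotent kernel, every `A`-algebra map `G : A ⊗_k B₀ → A ⊗_k C₀` between trivial charts is
the reduction of an `A'`-algebra map `F : A' ⊗_k B₀ → A' ⊗_k C₀`: `(π' ⊗ 1) (F x) = G ((π' ⊗ 1) x)` — lift `b ↦ G (1 ⊗ b)`
along `π' ⊗ 1 : A' ⊗_k C₀ ↠ A ⊗_k C₀` (nilpotent kernel `J·(A' ⊗_k C₀)`) by Prop. 4.4 and extend `A'`-linearly (the HOM
analogue of ★ `exists_algEquiv_lift`). [cite: Hartshorne2010, Prop. 4.4, p. 30] [cite: Hartshorne2010, Cor. 4.8 (proof), pp. 32–33] -/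
theorem exists_algHom_lift [Algebra.FormallySmooth k B₀] (π' : A' →ₐ[k] A) (hπ' : Function.Surjective π')
    (hJ : IsNilpotent (RingHom.ker π')) (G : A ⊗[k] B₀ →ₐ[A] A ⊗[k] C₀) :
    ∃ F : A' ⊗[k] B₀ →ₐ[A'] A' ⊗[k] C₀, ∀ x, reductionHom π' C₀ (F x) = G (reductionHom π' B₀ x) := by
  have hnil : IsNilpotent (RingHom.ker (reductionHom π' C₀ : A' ⊗[k] C₀ →+* A ⊗[k] C₀)) := by
    rw [show RingHom.ker (reductionHom π' C₀ : A' ⊗[k] C₀ →+* A ⊗[k] C₀) = RingHom.ker (reductionHom π' C₀) from rfl,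
      ker_reductionHom π' hπ']
    exact isNilpotent_map_of_isNilpotent hJ
  let σ₀ : B₀ →ₐ[k] A ⊗[k] C₀ :=
    (G.restrictScalars k).comp (Algebra.TensorProduct.includeRight (R := k) (A := A) (B := B₀))
  let σ' : B₀ →ₐ[k] A' ⊗[k] C₀ :=
    Algebra.FormallySmooth.liftOfSurjective σ₀ (reductionHom π' C₀) (reductionHom_surjective π' hπ') hnil
  have hσ' : ∀ b, reductionHom π' C₀ (σ' b) = G (1 ⊗ₜ b) := fun b => by
    rw [Algebra.FormallySmooth.liftOfSurjective_apply]
    rfl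
  exact ⟨baseChangeHom σ', map_baseChangeHom_of_lift π' (reductionHom π' C₀) (reductionHom_algebraMap π') G σ' hσ'⟩

end RingLevel

/-! ## §2 Scheme level: reductions of restricted chart maps -/

section SchemeLevel

variable {k : Type u} [Field k] {X Y : Over (Spec (CommRingCat.of k))}
  {A A₀ : Type u} [CommRing A] [Algebra k A] [CommRing A₀] [Algebra k A₀] (σ : A →ₐ[k] A₀)

/-- **Naturality of the restrictions of chart maps** under `σ̂ = σ ⊗ 1` (HOM analogue of ★ `reductionHom_algEquiv_restrict`):
if `F : A ⊗_k Γ(X, V) → A ⊗_k Γ(Y, V′)` (over `A`) LIFTS `G` (over `A₀`), `V` affine, `W = D(f) ⊆ V`, `W′ ⊆ V′`, and `ρ`, `ρ₀`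
are restrictions of `F`, `G` through the characterised base changes (`ρ ∘ Φ^X = Φ^Y ∘ F`, `ρ₀ ∘ Φ^X₀ = Φ^Y₀ ∘ G`), then `ρ` lifts
`ρ₀`: `σ̂ ∘ ρ = ρ₀ ∘ σ̂` (maps out of the localisation `A ⊗_k Γ(V)_f` are determined on `a ⊗ 1` and `1 ⊗ s|`).
[cite: Hartshorne2010, Thm. 10.2 (proof), p. 81] [cite: Hartshorne1977, III §4 p. 218] -/
theorem reductionHom_algHom_restrict [∀ W : X.left.Opens, Algebra k Γ(X.left, W)] [∀ W : Y.left.Opens, Algebra k Γ(Y.left, W)]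
    {V W : X.left.Opens} (hV : IsAffineOpen V) (f : Γ(X.left, V)) (hW : W = X.left.basicOpen f) (h : W ≤ V)
    {V' W' : Y.left.Opens} (h' : W' ≤ V')
    (F : A ⊗[k] Γ(X.left, V) →ₐ[A] A ⊗[k] Γ(Y.left, V')) (G : A₀ ⊗[k] Γ(X.left, V) →ₐ[A₀] A₀ ⊗[k] Γ(Y.left, V'))
    (hlift : ∀ x, reductionHom σ Γ(Y.left, V') (F x) = G (reductionHom σ Γ(X.left, V) x))
    {ΦX : A ⊗[k] Γ(X.left, V) →ₐ[A] A ⊗[k] Γ(X.left, W)}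
    (hΦX : ∀ a s, ΦX (a ⊗ₜ s) = a ⊗ₜ X.left.presheaf.map (homOfLE h).op s)
    {ΦX₀ : A₀ ⊗[k] Γ(X.left, V) →ₐ[A₀] A₀ ⊗[k] Γ(X.left, W)}
    (hΦX₀ : ∀ a s, ΦX₀ (a ⊗ₜ s) = a ⊗ₜ X.left.presheaf.map (homOfLE h).op s)
    {ΦY : A ⊗[k] Γ(Y.left, V') →ₐ[A] A ⊗[k] Γ(Y.left, W')}
    (hΦY : ∀ a s, ΦY (a ⊗ₜ s) = a ⊗ₜ Y.left.presheaf.map (homOfLE h').op s)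
    {ΦY₀ : A₀ ⊗[k] Γ(Y.left, V') →ₐ[A₀] A₀ ⊗[k] Γ(Y.left, W')}
    (hΦY₀ : ∀ a s, ΦY₀ (a ⊗ₜ s) = a ⊗ₜ Y.left.presheaf.map (homOfLE h').op s)
    {ρ : A ⊗[k] Γ(X.left, W) →ₐ[A] A ⊗[k] Γ(Y.left, W')} (hρ : ∀ x, ρ (ΦX x) = ΦY (F x))
    {ρ₀ : A₀ ⊗[k] Γ(X.left, W) →ₐ[A₀] A₀ ⊗[k] Γ(Y.left, W')} (hρ₀ : ∀ x, ρ₀ (ΦX₀ x) = ΦY₀ (G x))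
    (y : A ⊗[k] Γ(X.left, W)) :
    reductionHom σ Γ(Y.left, W') (ρ y) = ρ₀ (reductionHom σ Γ(X.left, W) y) := by
  have key : (reductionHom σ Γ(Y.left, W')).comp (ρ.restrictScalars k) =
      (ρ₀.restrictScalars k).comp (reductionHom σ Γ(X.left, W)) := by
    refine algHom_ext_of_basicOpen hV f hW h (fun r => ?_) (fun s => ?_)
    · change reductionHom σ Γ(Y.left, W') (ρ (r ⊗ₜ 1)) = ρ₀ (reductionHom σ Γ(X.left, W) (r ⊗ₜ 1))
      rw [algHom_apply_tmul_one, reductionHom_tmul, reductionHom_tmul, algHom_apply_tmul_one]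
    · change reductionHom σ Γ(Y.left, W') (ρ (1 ⊗ₜ X.left.presheaf.map (homOfLE h).op s)) =
        ρ₀ (reductionHom σ Γ(X.left, W) (1 ⊗ₜ X.left.presheaf.map (homOfLE h).op s))
      have e1 : ((1 : A) ⊗ₜ X.left.presheaf.map (homOfLE h).op s : A ⊗[k] Γ(X.left, W)) = ΦX (1 ⊗ₜ s) :=
        (hΦX 1 s).symm
      rw [e1, hρ, reductionHom_baseChangeMap σ h' hΦY hΦY₀, hlift, ← hρ₀, ← reductionHom_baseChangeMap σ h hΦX hΦX₀]
  exact AlgHom.congr_fun key y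

/-- `appLE` along equal morphisms (the `≤`-witnesses are propositions). [cite: Hartshorne1977, II.8 p. 172] -/
private theorem appLE_congr_hom {S T : Scheme.{u}} {g g' : S ⟶ T} (hg : g = g') (U : T.Opens) (V : S.Opens)
    (e : V ≤ g ⁻¹ᵁ U) (e' : V ≤ g' ⁻¹ᵁ U) : g.appLE U V e = g'.appLE U V e' := by
  subst hg
  rfl

end SchemeLevel

/-! ## §3 The chart lifts of a morphism of deformations -/

section ChartLifts

variable {k : Type u} [Field k] {A : Type u} [CommRing A] [Algebra k A] {J : Ideal A} (π' : (A ⧸ J) →ₐ[k] k)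
  -- the `X`-side: closed fibre `X`, deformation `𝒳`, inclusion `i`
  {X : Over (Spec (CommRingCat.of k))} [instΓX : ∀ W : X.left.Opens, Algebra k Γ(X.left, W)]
  (halgX : ∀ (W : X.left.Opens) (s : k), algebraMap k Γ(X.left, W) s = (constToPresheaf X).app (op W) s)
  {𝒳 : Over (Spec (CommRingCat.of (A ⧸ J)))} [instΓ𝒳 : ∀ W : 𝒳.left.Opens, Algebra (A ⧸ J) Γ(𝒳.left, W)]
  (halg𝒳 : ∀ (W : 𝒳.left.Opens) (a : A ⧸ J), algebraMap (A ⧸ J) Γ(𝒳.left, W) a = (constToPresheaf 𝒳).app (op W) a)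
  (i : X.left ⟶ 𝒳.left)
  -- the `Y`-side: closed fibre `Y`, deformation `𝒴`, inclusion `i'`
  {Y : Over (Spec (CommRingCat.of k))} [instΓY : ∀ W : Y.left.Opens, Algebra k Γ(Y.left, W)]
  (halgY : ∀ (W : Y.left.Opens) (s : k), algebraMap k Γ(Y.left, W) s = (constToPresheaf Y).app (op W) s)
  {𝒴 : Over (Spec (CommRingCat.of (A ⧸ J)))} [instΓ𝒴 : ∀ W : 𝒴.left.Opens, Algebra (A ⧸ J) Γ(𝒴.left, W)]
  (halg𝒴 : ∀ (W : 𝒴.left.Opens) (a : A ⧸ J), algebraMap (A ⧸ J) Γ(𝒴.left, W) a = (constToPresheaf 𝒴).app (op W) a)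
  (i' : Y.left ⟶ 𝒴.left)
  -- the morphism of deformations and its closed fibre
  (f : Y ⟶ X) (𝒻 : 𝒴 ⟶ 𝒳) (hsq : f.left ≫ i = i' ≫ 𝒻.left)

include halg𝒳 halg𝒴 in
/-- `𝒻♯ : Γ(𝒳, 𝒱) → Γ(𝒴, 𝒱′)` commutes with the `(A ⧸ J)`-structures (`𝒻` is a morphism OVER `Spec (A ⧸ J)`; cf. ★
`HodgeTheory.appLE_constToPresheaf`, ★ `appLE_algebraMap_eq_algebraMap`). [cite: Hartshorne1977, II.8 p. 172] -/
private theorem appLE_algebraMap_quot {𝒱 : 𝒳.left.Opens} {𝒱' : 𝒴.left.Opens} (h : 𝒱' ≤ 𝒻.left ⁻¹ᵁ 𝒱) (a : A ⧸ J) :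
    𝒻.left.appLE 𝒱 𝒱' h (algebraMap (A ⧸ J) Γ(𝒳.left, 𝒱) a) = algebraMap (A ⧸ J) Γ(𝒴.left, 𝒱') a := by
  rw [algebraMap_eq_appLE halg𝒳, algebraMap_eq_appLE halg𝒴, ← CommRingCat.comp_apply, Scheme.Hom.appLE_comp_appLE,
    appLE_congr_hom (Over.w 𝒻) ⊤ 𝒱' _ le_top]

include halgX halgY halg𝒳 halg𝒴 hsq in
/-- **CHART LIFTS OF A MORPHISM OF DEFORMATIONS, INTERTWINING THE TRANSITION LIFTS MODULO THE SQUARE-ZERO KERNEL.**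
For a morphism `𝒻 : 𝒴 → 𝒳` of flat deformations over `A ⧸ J` (`J² = 0`) of `f : Y → X` (`X` smooth over `k`), chart systems
`(e, ε₁, ε₂)` on a principal affine cover `U` of `X` (below `𝒰 ⊆ 𝒳`) and `(d, δ₁, δ₂)` on `U′ = f⁻¹U` (below `𝒰′ ⊆ 𝒻⁻¹𝒰`), over the
closed fibres, and `A`-lifts `ψX`, `ψY` of the two transition data (GAP-1's clause (L)), there are `A`-algebra maps
`F j : A ⊗_k Γ(X, U j) → A ⊗_k Γ(Y, U′ j)` with
(hF) `F j (1 ⊗ c) − 1 ⊗ f♯ c ∈ (mk_J⁻¹ 𝔫₀)·(A ⊗_k Γ(Y, U′ j))` for every ideal `𝔫₀ ⊇ ker π'` of `A ⧸ J`, and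
(hFψ) `F_l| (ψX j l (1 ⊗ c)) − ψY j l (F_j| (1 ⊗ c)) ∈ J·(A ⊗_k Γ(Y, U′ j ∩ U′ l))` for all characterised restrictions `F_j|, F_l|`
— the hypotheses `(F hF hFψ)` of ★ B2 `exists_cechMD1_eq_comap_obstruction_sub` (`A' := A`, `𝔫' := mk_J⁻¹ 𝔫₀`).  Road: `F j` lifts
`G j := (d j)⁻¹ ∘ 𝒻♯ ∘ e j` (§1); (hF) by the closed-fibre compatibilities and the square `f ≫ i = i' ≫ 𝒻`; (hFψ) after `σ̂ = mk_J ⊗ 1`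
both sides are `δ₂⁻¹ 𝒻♯ ε₁` on `U j ∩ U l` (§2). [cite: Hartshorne2010, Thm. 10.2 (proof), p. 81] [cite: Hartshorne2010, Prop. 4.4, p. 30]
[cite: Hartshorne2010, Cor. 4.8, pp. 32–33] -/
theorem exists_chartLifts_of_morphism [Smooth X.hom] (hJJ : J * J = ⊥) (𝔫₀ : Ideal (A ⧸ J)) (h𝔫₀ : RingHom.ker π' ≤ 𝔫₀)
    {ι : Type u} (U : ι → X.left.affineOpens) (b : (j l : ι) → Γ(X.left, (U j).1))
    (hb : ∀ j l, (U j).1 ⊓ (U l).1 = X.left.basicOpen (b j l))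
    (U' : ι → Y.left.affineOpens) (hU' : ∀ j, (U' j).1 = f.left ⁻¹ᵁ (U j).1)
    (𝒰 : ι → 𝒳.left.Opens) (hU : ∀ j, (U j).1 = i ⁻¹ᵁ 𝒰 j)
    (𝒰' : ι → 𝒴.left.Opens) (hU'' : ∀ j, (U' j).1 ≤ i' ⁻¹ᵁ 𝒰' j) (h𝒰' : ∀ j, 𝒰' j ≤ 𝒻.left ⁻¹ᵁ 𝒰 j)
    -- `X`-side charts (★ c2b `exists_transition_data_of_cover`)
    (e : ∀ j, (A ⧸ J) ⊗[k] Γ(X.left, (U j).1) ≃ₐ[A ⧸ J] Γ(𝒳.left, 𝒰 j))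
    (he : ∀ j x, i.appLE (𝒰 j) (U j).1 (hU j).le (e j x) = specialFibreHom π' _ x)
    (ε₁ ε₂ : ∀ j l, (A ⧸ J) ⊗[k] Γ(X.left, (U j).1 ⊓ (U l).1) ≃ₐ[A ⧸ J] Γ(𝒳.left, 𝒰 j ⊓ 𝒰 l))
    (hε₁ : ∀ j l (a : A ⧸ J) (s : Γ(X.left, (U j).1)),
      ε₁ j l (a ⊗ₜ X.left.presheaf.map (homOfLE inf_le_left).op s) =
        𝒳.left.presheaf.map (homOfLE inf_le_left).op (e j (a ⊗ₜ s)))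
    (hε₂ : ∀ j l (a : A ⧸ J) (s : Γ(X.left, (U l).1)),
      ε₂ j l (a ⊗ₜ X.left.presheaf.map (homOfLE inf_le_right).op s) =
        𝒳.left.presheaf.map (homOfLE inf_le_right).op (e l (a ⊗ₜ s)))
    -- `Y`-side charts
    (d : ∀ j, (A ⧸ J) ⊗[k] Γ(Y.left, (U' j).1) ≃ₐ[A ⧸ J] Γ(𝒴.left, 𝒰' j))
    (hd : ∀ j y, i'.appLE (𝒰' j) (U' j).1 (hU'' j) (d j y) = specialFibreHom π' _ y)
    (δ₁ δ₂ : ∀ j l, (A ⧸ J) ⊗[k] Γ(Y.left, (U' j).1 ⊓ (U' l).1) ≃ₐ[A ⧸ J] Γ(𝒴.left, 𝒰' j ⊓ 𝒰' l))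
    (hδ₁ : ∀ j l (a : A ⧸ J) (s : Γ(Y.left, (U' j).1)),
      δ₁ j l (a ⊗ₜ Y.left.presheaf.map (homOfLE inf_le_left).op s) =
        𝒴.left.presheaf.map (homOfLE inf_le_left).op (d j (a ⊗ₜ s)))
    (hδ₂ : ∀ j l (a : A ⧸ J) (s : Γ(Y.left, (U' l).1)),
      δ₂ j l (a ⊗ₜ Y.left.presheaf.map (homOfLE inf_le_right).op s) =
        𝒴.left.presheaf.map (homOfLE inf_le_right).op (d l (a ⊗ₜ s)))
    -- the two transition-lift systems (★ GAP-1 `exists_lifts_of_transition_data`, clause (L))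
    (ψX : ∀ j l, A ⊗[k] Γ(X.left, (U j).1 ⊓ (U l).1) ≃ₐ[A] A ⊗[k] Γ(X.left, (U j).1 ⊓ (U l).1))
    (hLX : ∀ j l x, Algebra.TensorProduct.map (Ideal.Quotient.mkₐ k J) (AlgHom.id k Γ(X.left, (U j).1 ⊓ (U l).1))
        (ψX j l x) = transition (ε₁ j l) (ε₂ j l)
        (Algebra.TensorProduct.map (Ideal.Quotient.mkₐ k J) (AlgHom.id k Γ(X.left, (U j).1 ⊓ (U l).1)) x))
    (ψY : ∀ j l, A ⊗[k] Γ(Y.left, (U' j).1 ⊓ (U' l).1) ≃ₐ[A] A ⊗[k] Γ(Y.left, (U' j).1 ⊓ (U' l).1))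
    (hLY : ∀ j l y, Algebra.TensorProduct.map (Ideal.Quotient.mkₐ k J) (AlgHom.id k Γ(Y.left, (U' j).1 ⊓ (U' l).1))
        (ψY j l y) = transition (δ₁ j l) (δ₂ j l)
        (Algebra.TensorProduct.map (Ideal.Quotient.mkₐ k J) (AlgHom.id k Γ(Y.left, (U' j).1 ⊓ (U' l).1)) y)) :
    ∃ F : ∀ j, A ⊗[k] Γ(X.left, (U j).1) →ₐ[A] A ⊗[k] Γ(Y.left, (U' j).1),
      (∀ j (c : Γ(X.left, (U j).1)),
        F j ((1 : A) ⊗ₜ c) - (1 : A) ⊗ₜ f.left.appLE (U j).1 (U' j).1 (hU' j).le c ∈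
          (𝔫₀.comap (Ideal.Quotient.mk J)) • (⊤ : Submodule A (A ⊗[k] Γ(Y.left, (U' j).1)))) ∧
      ∀ (j l : ι)
        (ΦXj : A ⊗[k] Γ(X.left, (U j).1) →ₐ[A] A ⊗[k] Γ(X.left, (U j).1 ⊓ (U l).1))
        (_ : ∀ a s, ΦXj (a ⊗ₜ s) = a ⊗ₜ X.left.presheaf.map (homOfLE inf_le_left).op s)
        (ΦXl : A ⊗[k] Γ(X.left, (U l).1) →ₐ[A] A ⊗[k] Γ(X.left, (U j).1 ⊓ (U l).1))
        (_ : ∀ a s, ΦXl (a ⊗ₜ s) = a ⊗ₜ X.left.presheaf.map (homOfLE inf_le_right).op s)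
        (ΦYj : A ⊗[k] Γ(Y.left, (U' j).1) →ₐ[A] A ⊗[k] Γ(Y.left, (U' j).1 ⊓ (U' l).1))
        (_ : ∀ a s, ΦYj (a ⊗ₜ s) = a ⊗ₜ Y.left.presheaf.map (homOfLE inf_le_left).op s)
        (ΦYl : A ⊗[k] Γ(Y.left, (U' l).1) →ₐ[A] A ⊗[k] Γ(Y.left, (U' j).1 ⊓ (U' l).1))
        (_ : ∀ a s, ΦYl (a ⊗ₜ s) = a ⊗ₜ Y.left.presheaf.map (homOfLE inf_le_right).op s)
        (Fj Fl : A ⊗[k] Γ(X.left, (U j).1 ⊓ (U l).1) →ₐ[A] A ⊗[k] Γ(Y.left, (U' j).1 ⊓ (U' l).1)),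
        (∀ x, Fj (ΦXj x) = ΦYj (F j x)) → (∀ x, Fl (ΦXl x) = ΦYl (F l x)) →
        ∀ c : Γ(X.left, (U j).1 ⊓ (U l).1),
          Fl (ψX j l ((1 : A) ⊗ₜ c)) - ψY j l (Fj ((1 : A) ⊗ₜ c)) ∈
            J • (⊤ : Submodule A (A ⊗[k] Γ(Y.left, (U' j).1 ⊓ (U' l).1))) := by
  classical
  -- the reduction `σ = mk_J : A → A ⧸ J`, surjective with square-zero (hence nilpotent) kernel `J`
  let σ : A →ₐ[k] A ⧸ J := Ideal.Quotient.mkₐ k J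
  have hσ : Function.Surjective σ := Ideal.Quotient.mkₐ_surjective k J
  have hker : RingHom.ker σ = J := Ideal.Quotient.mkₐ_ker k J
  have hnil : IsNilpotent (RingHom.ker σ) := ⟨2, by rw [pow_two, hker, hJJ]; rfl⟩
  -- `𝒻♯` on the charts and on their overlaps, as `(A ⧸ J)`-algebra maps
  have h𝒰'₂ : ∀ j l, 𝒰' j ⊓ 𝒰' l ≤ 𝒻.left ⁻¹ᵁ (𝒰 j ⊓ 𝒰 l) := fun j l =>
    (inf_le_inf (h𝒰' j) (h𝒰' l)).trans 𝒻.left.preimage_inf.ge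
  let g𝒻 : ∀ j, Γ(𝒳.left, 𝒰 j) →ₐ[A ⧸ J] Γ(𝒴.left, 𝒰' j) := fun j =>
    { (𝒻.left.appLE (𝒰 j) (𝒰' j) (h𝒰' j)).hom with commutes' := appLE_algebraMap_quot halg𝒳 halg𝒴 𝒻 (h𝒰' j) }
  have hg𝒻 : ∀ j z, g𝒻 j z = 𝒻.left.appLE (𝒰 j) (𝒰' j) (h𝒰' j) z := fun _ _ => rfl
  let g𝒻₂ : ∀ j l, Γ(𝒳.left, 𝒰 j ⊓ 𝒰 l) →ₐ[A ⧸ J] Γ(𝒴.left, 𝒰' j ⊓ 𝒰' l) := fun j l =>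
    { (𝒻.left.appLE (𝒰 j ⊓ 𝒰 l) (𝒰' j ⊓ 𝒰' l) (h𝒰'₂ j l)).hom with
      commutes' := appLE_algebraMap_quot halg𝒳 halg𝒴 𝒻 (h𝒰'₂ j l) }
  have hg𝒻₂ : ∀ j l z, g𝒻₂ j l z = 𝒻.left.appLE (𝒰 j ⊓ 𝒰 l) (𝒰' j ⊓ 𝒰' l) (h𝒰'₂ j l) z := fun _ _ _ => rfl
  -- (1) the chart maps of `𝒻` over `A ⧸ J`: `G j = (d j)⁻¹ ∘ 𝒻♯ ∘ e j`
  let G : ∀ j, (A ⧸ J) ⊗[k] Γ(X.left, (U j).1) →ₐ[A ⧸ J] (A ⧸ J) ⊗[k] Γ(Y.left, (U' j).1) := fun j =>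
    (((d j).symm : Γ(𝒴.left, 𝒰' j) →ₐ[A ⧸ J] (A ⧸ J) ⊗[k] Γ(Y.left, (U' j).1)).comp (g𝒻 j)).comp (e j)
  have hG : ∀ j x, G j x = (d j).symm (𝒻.left.appLE (𝒰 j) (𝒰' j) (h𝒰' j) (e j x)) := fun _ _ => rfl
  -- (2) their `A`-lifts (§1; the chart rings `Γ(X, U j)` are formally smooth over `k`)
  have hlift : ∀ j, ∃ F : A ⊗[k] Γ(X.left, (U j).1) →ₐ[A] A ⊗[k] Γ(Y.left, (U' j).1),
      ∀ x, reductionHom σ _ (F x) = G j (reductionHom σ _ x) := fun j => by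
    haveI : Algebra.FormallySmooth k Γ(X.left, (U j).1) := formallySmooth_sections_halg_of_isAffineOpen halgX (U j).2
    exact exists_algHom_lift σ hσ hnil (G j)
  choose F hFlift using hlift
  -- the square on sections: `i'♯ (𝒻♯ z) = f♯ (i♯ z)`
  have hsq' : ∀ j (z : Γ(𝒳.left, 𝒰 j)), i'.appLE (𝒰' j) (U' j).1 (hU'' j) (𝒻.left.appLE (𝒰 j) (𝒰' j) (h𝒰' j) z) =
      f.left.appLE (U j).1 (U' j).1 (hU' j).le (i.appLE (𝒰 j) (U j).1 (hU j).le z) := fun j z => by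
    rw [← CommRingCat.comp_apply, ← CommRingCat.comp_apply, Scheme.Hom.appLE_comp_appLE, Scheme.Hom.appLE_comp_appLE,
      appLE_congr_hom hsq]
  refine ⟨F, fun j c => ?_, ?_⟩
  · -- (hF) `F j ≡ 1 ⊗ f♯ (mod mk_J⁻¹ 𝔫₀)`: reduce by `σ̂`, then the closed-fibre compatibilities and the square
    refine mem_comap_smul_top_of_reductionHom_mem σ hσ 𝔫₀ ?_
    rw [map_sub, hFlift, reductionHom_tmul, reductionHom_tmul, map_one]
    refine Submodule.smul_mono_left h𝔫₀ (ker_specialFibreHom_le π' _ ?_)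
    have hdsymm : ∀ z, specialFibreHom π' _ ((d j).symm z) = i'.appLE (𝒰' j) (U' j).1 (hU'' j) z := fun z => by
      rw [← hd j ((d j).symm z), AlgEquiv.apply_symm_apply]
    rw [map_sub, sub_eq_zero, hG, hdsymm, hsq', he, specialFibreHom_tmul, specialFibreHom_tmul, map_one, one_smul,
      one_smul]
  -- (hFψ) the intertwining identity modulo `J`
  intro j l ΦXj hΦXj ΦXl hΦXl ΦYj hΦYj ΦYl hΦYl Fj Fl hFj hFl c
  rw [← hker, ← reductionHom_eq_zero_iff σ hσ, map_sub, sub_eq_zero]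
  have hLXr : ∀ x, reductionHom σ _ (ψX j l x) = transition (ε₁ j l) (ε₂ j l) (reductionHom σ _ x) := hLX j l
  have hLYr : ∀ y, reductionHom σ _ (ψY j l y) = transition (δ₁ j l) (δ₂ j l) (reductionHom σ _ y) := hLY j l
  -- base changes over `A ⧸ J`
  obtain ⟨ΨXj, hΨXj⟩ := exists_baseChangeMap (A' := A ⧸ J) halgX (U j).1 ((U j).1 ⊓ (U l).1) inf_le_left
  obtain ⟨ΨXl, hΨXl⟩ := exists_baseChangeMap (A' := A ⧸ J) halgX (U l).1 ((U j).1 ⊓ (U l).1) inf_le_right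
  obtain ⟨ΨYj, hΨYj⟩ := exists_baseChangeMap (A' := A ⧸ J) halgY (U' j).1 ((U' j).1 ⊓ (U' l).1) inf_le_left
  obtain ⟨ΨYl, hΨYl⟩ := exists_baseChangeMap (A' := A ⧸ J) halgY (U' l).1 ((U' j).1 ⊓ (U' l).1) inf_le_right
  -- the explicit overlap maps `Ḡj = δ₁⁻¹ 𝒻♯ ε₁`, `Ḡl = δ₂⁻¹ 𝒻♯ ε₂` over `A ⧸ J`
  let Gj : (A ⧸ J) ⊗[k] Γ(X.left, (U j).1 ⊓ (U l).1) →ₐ[A ⧸ J] (A ⧸ J) ⊗[k] Γ(Y.left, (U' j).1 ⊓ (U' l).1) :=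
    (((δ₁ j l).symm : Γ(𝒴.left, 𝒰' j ⊓ 𝒰' l) →ₐ[A ⧸ J] (A ⧸ J) ⊗[k] Γ(Y.left, (U' j).1 ⊓ (U' l).1)).comp
      (g𝒻₂ j l)).comp (ε₁ j l)
  let Gl : (A ⧸ J) ⊗[k] Γ(X.left, (U j).1 ⊓ (U l).1) →ₐ[A ⧸ J] (A ⧸ J) ⊗[k] Γ(Y.left, (U' j).1 ⊓ (U' l).1) :=
    (((δ₂ j l).symm : Γ(𝒴.left, 𝒰' j ⊓ 𝒰' l) →ₐ[A ⧸ J] (A ⧸ J) ⊗[k] Γ(Y.left, (U' j).1 ⊓ (U' l).1)).comp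
      (g𝒻₂ j l)).comp (ε₂ j l)
  have hGj : ∀ z, Gj z = (δ₁ j l).symm (𝒻.left.appLE (𝒰 j ⊓ 𝒰 l) (𝒰' j ⊓ 𝒰' l) (h𝒰'₂ j l) (ε₁ j l z)) :=
    fun _ => rfl
  have hGl : ∀ z, Gl z = (δ₂ j l).symm (𝒻.left.appLE (𝒰 j ⊓ 𝒰 l) (𝒰' j ⊓ 𝒰' l) (h𝒰'₂ j l) (ε₂ j l z)) :=
    fun _ => rfl
  -- `ε`/`δ` restrict `e`/`d` on ALL elements (from the pure-tensor clauses)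
  have hε₁' : ∀ x, ε₁ j l (ΨXj x) = 𝒳.left.presheaf.map (homOfLE inf_le_left).op (e j x) := fun x => by
    induction x using TensorProduct.induction_on with
    | zero => simp only [map_zero]
    | tmul a s => rw [hΨXj, hε₁]
    | add x y hx hy => simp only [map_add, hx, hy]
  have hε₂' : ∀ x, ε₂ j l (ΨXl x) = 𝒳.left.presheaf.map (homOfLE inf_le_right).op (e l x) := fun x => by
    induction x using TensorProduct.induction_on with
    | zero => simp only [map_zero]
    | tmul a s => rw [hΨXl, hε₂]
    | add x y hx hy => simp only [map_add, hx, hy]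
  have hδ₁' : ∀ z, ΨYj ((d j).symm z) = (δ₁ j l).symm (𝒴.left.presheaf.map (homOfLE inf_le_left).op z) := fun z => by
    rw [AlgEquiv.eq_symm_apply]
    obtain ⟨y, rfl⟩ := (d j).surjective z
    rw [AlgEquiv.symm_apply_apply]
    induction y using TensorProduct.induction_on with
    | zero => simp only [map_zero]
    | tmul a s => rw [hΨYj, hδ₁]
    | add x y hx hy => simp only [map_add, hx, hy]
  have hδ₂' : ∀ z, ΨYl ((d l).symm z) = (δ₂ j l).symm (𝒴.left.presheaf.map (homOfLE inf_le_right).op z) := fun z => by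
    rw [AlgEquiv.eq_symm_apply]
    obtain ⟨y, rfl⟩ := (d l).surjective z
    rw [AlgEquiv.symm_apply_apply]
    induction y using TensorProduct.induction_on with
    | zero => simp only [map_zero]
    | tmul a s => rw [hΨYl, hδ₂]
    | add x y hx hy => simp only [map_add, hx, hy]
  -- `𝒻♯` commutes with the restrictions
  have hnatj : ∀ z : Γ(𝒳.left, 𝒰 j), 𝒻.left.appLE (𝒰 j ⊓ 𝒰 l) (𝒰' j ⊓ 𝒰' l) (h𝒰'₂ j l)
      (𝒳.left.presheaf.map (homOfLE inf_le_left).op z) =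
      𝒴.left.presheaf.map (homOfLE inf_le_left).op (𝒻.left.appLE (𝒰 j) (𝒰' j) (h𝒰' j) z) := fun z => by
    rw [← CommRingCat.comp_apply, Scheme.Hom.map_appLE, ← CommRingCat.comp_apply, Scheme.Hom.appLE_map]
  have hnatl : ∀ z : Γ(𝒳.left, 𝒰 l), 𝒻.left.appLE (𝒰 j ⊓ 𝒰 l) (𝒰' j ⊓ 𝒰' l) (h𝒰'₂ j l)
      (𝒳.left.presheaf.map (homOfLE inf_le_right).op z) =
      𝒴.left.presheaf.map (homOfLE inf_le_right).op (𝒻.left.appLE (𝒰 l) (𝒰' l) (h𝒰' l) z) := fun z => by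
    rw [← CommRingCat.comp_apply, Scheme.Hom.map_appLE, ← CommRingCat.comp_apply, Scheme.Hom.appLE_map]
  -- `Ḡj`, `Ḡl` ARE the restrictions of `G j`, `G l`
  have hGjres : ∀ x, Gj (ΨXj x) = ΨYj (G j x) := fun x => by
    rw [hGj, hG, hε₁', hnatj, hδ₁']
  have hGlres : ∀ x, Gl (ΨXl x) = ΨYl (G l x) := fun x => by
    rw [hGl, hG, hε₂', hnatl, hδ₂']
  -- hence `Fj`, `Fl` lift `Ḡj`, `Ḡl` (§2)
  have hVlj : (U j).1 ⊓ (U l).1 = X.left.basicOpen (b l j) := by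
    rw [inf_comm]
    exact hb l j
  have hredj : ∀ y, reductionHom σ _ (Fj y) = Gj (reductionHom σ _ y) :=
    reductionHom_algHom_restrict σ (U j).2 (b j l) (hb j l) inf_le_left inf_le_left (F j) (G j) (hFlift j)
      hΦXj hΨXj hΦYj hΨYj hFj hGjres
  have hredl : ∀ y, reductionHom σ _ (Fl y) = Gl (reductionHom σ _ y) :=
    reductionHom_algHom_restrict σ (U l).2 (b l j) hVlj inf_le_right inf_le_right (F l) (G l) (hFlift l)
      hΦXl hΨXl hΦYl hΨYl hFl hGlres
  -- both sides are `δ₂⁻¹ 𝒻♯ ε₁`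
  rw [hredl, hLXr, hLYr, hredj, hGl, hGj]
  simp only [transition_apply, AlgEquiv.apply_symm_apply]

end ChartLifts

end Literature.AlgebraicGeometry.Deformation

end
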